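import Summits.CriticalPhenomena.PercolationContinuityZ3.Theses.PercOpenSupercrit
import Summits.CriticalPhenomena.PercolationContinuityZ3.Theorems.PercFiniteBoxLRORenormaliseFromLinearLRONoGoodBoxAtPc
import Literature.Probability.Percolation.BernoulliPercolationProofs

/-!
# Strategy census (crux-strategist) — crux `GoodBoxesLikelyWhenPercolating` (stmt-CriticalPhenomena-3826)

Kernel-checked backbone of `STRATEGY-CENSUS.md` for the one remaining crux r2 of route
`route-CriticalPhenomena-PercOpenSupercrit` (sub-problem `PercolationContinuityZ3`).

THE COLLAPSE. Two theorems landed by the sibling route `PercFiniteBoxLRO` (line `registered` of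
crux stmt-0857) change the status of r2:

* `goodBoxCriterionSameP_proof` (p151477): the same-`p` criterion r3 of THIS route is proved, so the
  certified deciding theorem gives `r2 → θ(p_c) = 0` in one line (`continuity_of_crux`);
* `real_goodBox_criticalProbI_le` / `stub_noGoodBoxAtPc`: `∃ δ₀ > 0, ∀ n ≥ 1, P_{p_c}(G_n) ≤ 1 − δ₀`
  UNCONDITIONALLY, so the crux READ AT `p = p_c` is literally `¬ (0 < θ(p_c))`
  (`critGoodBoxes_iff`), and the crux splits DEFINITIONALLY as
  `r2 ↔ (θ(p_c) = 0) ∧ (∀ p > p_c, good boxes (1−δ)-likely at some scale)` (`crux_iff`), the second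
  conjunct being Grimmett's Theorem (7.61) for the typed event (known; its inputs GM (7.2)(a),
  Lemma (7.78), Lemma (7.89) are in the tree).

Consequently every line of attack on r2 is a line of attack on the conjunct itself plus known
supercritical static renormalisation; the census (`STRATEGY-CENSUS.md`) records why no language
switch native to this crux has teeth that are not already staffed as a sibling route's crux.

Also recorded: under the jump hypothesis, once birth's closable stub `stub_crossingClusterLikely`
holds at `p_c`, in-box uniqueness at linear scale FAILS with probability `≥ δ₀/2` at EVERY large
scale (`uniq_fails_at_pc_of_jump`) — the crux-native form of the barrier
`Literature.Barriers.CriticalPhenomena.SameDensityLocalUniqueness` for the typed geometry, showing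
that birth's load-bearing stub `stub_linearUniquenessFrequently` ("frequently in n") has no more
room than "eventually in n".
-/

noncomputable section

namespace Summit.CriticalPhenomena.PercolationContinuityZ3.Cruxes.GoodBoxesLikelyWhenPercolating.StrategyCensus

open MeasureTheory Literature.Probability.Percolation Literature.Probability.LatticeModels
open Summit.CriticalPhenomena.PercolationContinuityZ3.Theses.PercOpenSupercrit
open Summit.CriticalPhenomena.PercolationContinuityZ3.Theorems.RenormaliseFromLinearLRO
  (goodBox goodBoxCriterionSameP_proof real_goodBox_criticalProbI_le)

/-! ## The two halves of the crux -/

/-- **Supercritical good boxes** (Grimmett 1999, Thm. (7.61) for the typed event `goodBox`, the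
regime `p > p_c` only): for every `p > p_c(ℤ³)` and every `δ > 0` some scale `n ≥ 1` has
`P_p(G_n) > 1 − δ`. KNOWN (Grimmett pp. 181–190; tree: `slab_blocks`, `StaticRenormalizationSlabs`,
`StaticRenormalizationTwoArms`, `StaticRenormalizationBlocks`; missing (7.99)–(7.104)). -/
def SupercritGoodBoxes : Prop :=
  ∀ p : unitInterval, criticalProb (zdGraph 3) (0 : Site 3) < (p : ℝ) → ∀ δ : ℝ, 0 < δ →
    ∃ n : ℕ, 1 ≤ n ∧ 1 - δ < (bondPercolation (zdGraph 3) p).real (goodBox n)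

/-- **The crux read at the critical point**: `θ(p_c) > 0 ⇒ ∀ δ ∃ n ≥ 1, P_{p_c}(G_n) > 1 − δ`. -/
def CritGoodBoxes : Prop :=
  0 < theta (zdGraph 3) (0 : Site 3) (criticalProbI 3) → ∀ δ : ℝ, 0 < δ →
    ∃ n : ℕ, 1 ≤ n ∧ 1 - δ < (bondPercolation (zdGraph 3) (criticalProbI 3)).real (goodBox n)

/-- The crux is verbatim the `goodBox` statement (definitional unfolding only). -/
theorem crux_iff_goodBox :
    GoodBoxesLikelyWhenPercolating ↔
      ∀ p : unitInterval, 0 < theta (zdGraph 3) (0 : Site 3) p → ∀ δ : ℝ, 0 < δ →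
        ∃ n : ℕ, 1 ≤ n ∧ 1 - δ < (bondPercolation (zdGraph 3) p).real (goodBox n) :=
  Iff.rfl

/-! ## (1) crux ⇒ conjunct: one line, by the certified `closes` and the landed r3 -/

/-- `r2 → θ(p_c) = 0`: the route's deciding theorem with its second hypothesis discharged by the
landed proof of r3 (`goodBoxCriterionSameP_proof`, p151477). -/
theorem continuity_of_crux (h : GoodBoxesLikelyWhenPercolating) : _root_.PercolationContinuityZ3 :=
  closes h goodBoxCriterionSameP_proof

/-! ## (2) crux ⇒ supercritical half (restriction to `p > p_c`) -/

theorem supercrit_of_crux (h : GoodBoxesLikelyWhenPercolating) : SupercritGoodBoxes :=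
  fun p hp δ hδ => h p (theta_pos_of_criticalProb_lt_holds (zdGraph 3) (0 : Site 3) p hp) δ hδ

/-! ## (3) conjunct ∧ supercritical half ⇒ crux -/

/-- If `θ(p_c) = 0` then every percolating `p` is `> p_c`, where (7.61) applies. -/
theorem crux_of_continuity_of_supercrit (hS : _root_.PercolationContinuityZ3)
    (hG : SupercritGoodBoxes) : GoodBoxesLikelyWhenPercolating := by
  intro p hp δ hδ
  refine hG p ?_ δ hδ
  by_contra hle
  push Not at hle
  rcases hle.lt_or_eq with hlt | heq
  · have h0 : theta (zdGraph 3) (0 : Site 3) p = 0 :=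
      theta_eq_zero_of_lt_criticalProb_holds (zdGraph 3) (0 : Site 3) p hlt
    exact absurd h0 (ne_of_gt hp)
  · have hpc : p = criticalProbI 3 := Subtype.ext heq
    rw [hpc] at hp
    exact absurd hS (ne_of_gt hp)

/-- **THE COLLAPSE.** `r2 ↔ (θ(p_c) = 0) ∧ (supercritical good boxes, p > p_c)`. -/
theorem crux_iff : GoodBoxesLikelyWhenPercolating ↔ (_root_.PercolationContinuityZ3 ∧ SupercritGoodBoxes) :=
  ⟨fun h => ⟨continuity_of_crux h, supercrit_of_crux h⟩,
    fun h => crux_of_continuity_of_supercrit h.1 h.2⟩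

/-! ## (4) the critical case alone is already the conjunct (NoGoodBoxAtPc, landed) -/

/-- `CritGoodBoxes ↔ θ(p_c) = 0`: under the jump `θ(p_c) > 0` the crux at `p_c` contradicts the
landed `P_{p_c}(G_n) ≤ 1 − δ₀ ∀ n`; conversely it is vacuous. -/
theorem critGoodBoxes_iff : CritGoodBoxes ↔ _root_.PercolationContinuityZ3 := by
  constructor
  · intro h
    show theta (zdGraph 3) (0 : Site 3) (criticalProbI 3) = 0
    by_contra hne
    have hpos : 0 < theta (zdGraph 3) (0 : Site 3) (criticalProbI 3) :=
      lt_of_le_of_ne measureReal_nonneg (Ne.symm hne)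
    obtain ⟨δ, hδ, hle⟩ := real_goodBox_criticalProbI_le
    obtain ⟨n, hn, hgt⟩ := h hpos δ hδ
    exact absurd (hle n hn) (not_le.2 hgt)
  · intro hS hpos
    exact absurd hS (ne_of_gt hpos)

/-! ## (5) under the jump, linear-scale in-box uniqueness fails at EVERY large scale -/

/-- Outer-measure union bound (copied from the birth skeleton's proved plumbing): if the failure
sets of `P` and `Q` have probability `< a` and `< b`, then `{P ∧ Q}` has probability `> 1 − (a+b)`. -/
theorem one_sub_lt_measureReal_setOf_and {α : Type*} [MeasurableSpace α] (μ : Measure α)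
    [IsProbabilityMeasure μ] {P Q : α → Prop} {a b : ℝ}
    (hP : μ.real {ω | ¬ P ω} < a) (hQ : μ.real {ω | ¬ Q ω} < b) :
    1 - (a + b) < μ.real {ω | P ω ∧ Q ω} := by
  have hcover : (Set.univ : Set α) ⊆ {ω | P ω ∧ Q ω} ∪ ({ω | ¬ P ω} ∪ {ω | ¬ Q ω}) := by
    intro ω _
    by_cases hPω : P ω
    · by_cases hQω : Q ω
      · exact Or.inl ⟨hPω, hQω⟩
      · exact Or.inr (Or.inr hQω)
    · exact Or.inr (Or.inl hPω)
  have h1 : (1 : ℝ) ≤ μ.real {ω | P ω ∧ Q ω} + (μ.real {ω | ¬ P ω} + μ.real {ω | ¬ Q ω}) :=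
    calc (1 : ℝ) = μ.real (Set.univ : Set α) := probReal_univ.symm
      _ ≤ μ.real ({ω | P ω ∧ Q ω} ∪ ({ω | ¬ P ω} ∪ {ω | ¬ Q ω})) := measureReal_mono hcover
      _ ≤ μ.real {ω | P ω ∧ Q ω} + μ.real ({ω | ¬ P ω} ∪ {ω | ¬ Q ω}) := measureReal_union_le _ _
      _ ≤ μ.real {ω | P ω ∧ Q ω} + (μ.real {ω | ¬ P ω} + μ.real {ω | ¬ Q ω}) := by
          gcongr; exact measureReal_union_le _ _
  linarith

/-- The crossing clause CROSS_n of the typed good box. -/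
def Cross (n : ℕ) (ω : BondConfig (Site 3)) : Prop :=
  ∃ x : Site 3, ∀ i : Fin 3,
    (∃ u : Site 3, u i = -(n : ℤ) ∧ ω ∈ openConnIn ↑(box 3 n) x u) ∧
    (∃ v : Site 3, v i = (n : ℤ) ∧ ω ∈ openConnIn ↑(box 3 n) x v)

/-- The in-box uniqueness clause UNIQ_n of the typed good box. -/
def Uniq (n : ℕ) (ω : BondConfig (Site 3)) : Prop :=
  ∀ x y : Site 3,
    (∃ u v : Site 3, ω ∈ openConnIn ↑(box 3 n) x u ∧ ω ∈ openConnIn ↑(box 3 n) x v ∧ ∃ i, (n : ℤ) ≤ |u i - v i|) →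
    (∃ u v : Site 3, ω ∈ openConnIn ↑(box 3 n) y u ∧ ω ∈ openConnIn ↑(box 3 n) y v ∧ ∃ i, (n : ℤ) ≤ |u i - v i|) →
    ω ∈ openConnIn ↑(box 3 n) x y

/-- `goodBox n = {CROSS_n ∧ UNIQ_n}` (definitional). -/
theorem goodBox_eq (n : ℕ) : goodBox n = {ω | Cross n ω ∧ Uniq n ω} := rfl

/-- **Under the jump, UNIQ fails at every large scale** (crux-native `SameDensityLocalUniqueness`):
if crossing clusters are eventually likely at `p_c` (birth's closable `stub_crossingClusterLikely`
read at `p = p_c`) and `θ(p_c) > 0`, then with the `δ₀` of NoGoodBoxAtPc,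
`P_{p_c}(¬ UNIQ_n) ≥ δ₀/2` for all large `n`. So birth's load-bearing stub
`stub_linearUniquenessFrequently` is, at `p_c`, false in the jump world at EVERY large scale:
"frequently in `n`" buys nothing over "eventually". -/
theorem uniq_fails_at_pc_of_jump
    (hCross : ∀ δ : ℝ, 0 < δ → ∃ N : ℕ, ∀ n : ℕ, N ≤ n →
      (bondPercolation (zdGraph 3) (criticalProbI 3)).real {ω | ¬ Cross n ω} < δ)
    (_hjump : 0 < theta (zdGraph 3) (0 : Site 3) (criticalProbI 3)) :
    ∃ δ₀ : ℝ, 0 < δ₀ ∧ ∃ N : ℕ, ∀ n : ℕ, N ≤ n →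
      δ₀ / 2 ≤ (bondPercolation (zdGraph 3) (criticalProbI 3)).real {ω | ¬ Uniq n ω} := by
  obtain ⟨δ₀, hδ₀, hle⟩ := real_goodBox_criticalProbI_le
  obtain ⟨N, hN⟩ := hCross (δ₀ / 2) (half_pos hδ₀)
  refine ⟨δ₀, hδ₀, max N 1, fun n hn => ?_⟩
  by_contra hlt
  push Not at hlt
  have hC := hN n ((le_max_left N 1).trans hn)
  have h := one_sub_lt_measureReal_setOf_and (bondPercolation (zdGraph 3) (criticalProbI 3)) hC hlt
  rw [add_halves] at h
  have hgood := hle n ((le_max_right N 1).trans hn)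
  rw [goodBox_eq] at hgood
  linarith

end Summit.CriticalPhenomena.PercolationContinuityZ3.Cruxes.GoodBoxesLikelyWhenPercolating.StrategyCensus

end
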